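import Summits.AtomisticToContinuum.HydrodynamicLimit.Theses.CompensatedSlabClusters
import Summits.AtomisticToContinuum.HydrodynamicLimit.Theses.ImplosionDichotomy

/-!
# `PayloadClosure` (stmt-AtomisticToContinuum-9053) — typed decomposition attempts (strategy census §Decomposition)

Crux-strategist r1, REDIRECT pass (2026-08-17), route CompensatedSlabClusters. Sorry-free.

The crux (FIXED): `PayloadClosure ↔ (CollisionPayloadTight → L2HydroFields)` (`Iff.rfl`), conclusion = the
UNGUARDED mean-square hydrodynamic limit for ALL classical solutions and all `T`.

* **D1 (regime split through the shared PDE crux).** Pieces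
  `X₁ := ImplosionDichotomy.DiluteSelfConsistency` (stmt-3091: admissible classical solutions stay below any packing
  level `η` for `σ < σ₀(η, profiles)`) and `X₂ := PayloadClosureProfilewiseBand` (the crux with a PROFILE-WISE packing
  guard on the classical solution, typed below). Assembly `d1_assembly : X₁ → X₂ → PayloadClosure` PROVED (min of the
  two thresholds; the guard of X₂ is discharged by X₁ through the same flow family and its t = 0 tie).
  It is the best typed split available and it is NOT an honest redirect: X₁ is expected FALSE in substance
  (`DiluteSelfConsistency ↔ ¬ DenseExcursion` landed, DenseExcursion numerically true — standing disprover of 3091,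
  `Cruxes/DiluteSelfConsistency/Disproof.lean` verdict), and X₂ is again "the (profile-wise guarded) summit given the
  a-priori module": `x2_of_profilewise` shows the guarded waypoint ALONE gives X₂ (module unused), and
  `profilewise_summit_of_x2` shows X₂ + module ⇒ the profile-wise guarded limit `HydroLimitProfilewiseBand`
  (stmt-17372, itself flagged "it is the hydrodynamic limit itself under a packing cap").
* **D2/D3** (tightness split; BoxDissipativeWeakStrong transplant) are discussed in STRATEGY-CENSUS.md; D3 does not
  even assemble to the crux because every typed closure engine in the tree concludes only a GUARDED limit.
-/

namespace Summit.AtomisticToContinuum.HydrodynamicLimit.Cruxes.PayloadClosure.Census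

open scoped BigOperators Topology Classical MeasureTheory ProbabilityTheory InnerProductSpace
open Filter Set Function TopologicalSpace MeasureTheory
open Literature.MathematicalPhysics.KineticTheory
open Summit.AtomisticToContinuum.HydrodynamicLimit.Theses.CompensatedSlabClusters
open Summit.AtomisticToContinuum.HydrodynamicLimit.Theses.ImplosionDichotomy (DiluteSelfConsistency
  HydroLimitProfilewiseBand)

/-- The mean-square conclusion of the crux at a macroscopic time `t` (the body shared by `L2HydroFields`,
`PayloadClosure` and the pieces below), as a predicate on (σ, profiles, solution, flows, t). -/
def L2At (σ : ℝ) (a₀ θ₀ : T3 → ℝ) (u₀ : T3 → V3) (ρ θ : ℝ → T3 → ℝ) (u : ℝ → T3 → V3)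
    (Φ : (N : ℕ) → Literature.Analysis.FluidPDE.HardSphereFlow
      (Literature.Analysis.FluidPDE.Torus.geometry (Fin 3)) (hsDiameter σ N) (N + 1)) (t : ℝ) : Prop :=
  ∀ χ : T3 → ℝ, Continuous χ →
    Tendsto (fun N : ℕ => ∫⁻ z, ENNReal.ofReal (|empiricalDensityField ((Φ N).flow t z) χ - ∫ x, χ x * ρ t x| ^ 2)
      ∂(localGibbsLaw σ a₀ u₀ θ₀ N (Φ N))) atTop (nhds 0) ∧
    Tendsto (fun N : ℕ => ∫⁻ z, ENNReal.ofReal (‖empiricalMomentumField ((Φ N).flow t z) χ -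
      ∫ x, (χ x * ρ t x) • u t x‖ ^ 2) ∂(localGibbsLaw σ a₀ u₀ θ₀ N (Φ N))) atTop (nhds 0) ∧
    Tendsto (fun N : ℕ => ∫⁻ z, ENNReal.ofReal (|empiricalEnergyField ((Φ N).flow t z) χ -
      ∫ x, χ x * totalEnergyDensity (ρ t x) (u t x) (θ t x)| ^ 2) ∂(localGibbsLaw σ a₀ u₀ θ₀ N (Φ N)))
      atTop (nhds 0)

/-- Sanity: the shared waypoint is literally "`L2At` for all small σ, all classical solutions, all t < T". -/
theorem l2HydroFields_iff :
    L2HydroFields ↔ ∀ (a₀ θ₀ : T3 → ℝ) (u₀ : T3 → V3), Continuous a₀ → Continuous θ₀ → Continuous u₀ →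
      (∀ x, 0 < a₀ x) → (∀ x, 0 < θ₀ x) → ∃ σ₀ : ℝ, 0 < σ₀ ∧ ∀ σ : ℝ, 0 < σ → σ < σ₀ →
        ∀ (T : ℝ) (ρ θ : ℝ → T3 → ℝ) (u : ℝ → T3 → V3), IsHardSphereEulerSolution σ T ρ u θ →
          ∀ Φ : (N : ℕ) → Literature.Analysis.FluidPDE.HardSphereFlow
              (Literature.Analysis.FluidPDE.Torus.geometry (Fin 3)) (hsDiameter σ N) (N + 1),
            TendstoHydroFieldsAt (fun N => localGibbsLaw σ a₀ u₀ θ₀ N (Φ N)) Φ ρ u θ 0 →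
              ∀ t ∈ Ico 0 T, L2At σ a₀ θ₀ u₀ ρ θ u Φ t :=
  Iff.rfl

/-! ### D1 — regime split through `DiluteSelfConsistency` -/

/-- Piece X₂ of D1: the crux with a PROFILE-WISE packing guard `ρ_t(x)σ³ < η`, `η = η(profiles) > 0`, on the
classical solution (the shape in which every perturbative closure engine concludes; cf. stmt-17372). -/
def PayloadClosureProfilewiseBand : Prop :=
  CollisionPayloadTight →
    ∀ (a₀ θ₀ : T3 → ℝ) (u₀ : T3 → V3), Continuous a₀ → Continuous θ₀ → Continuous u₀ →
      (∀ x, 0 < a₀ x) → (∀ x, 0 < θ₀ x) → ∃ η : ℝ, 0 < η ∧ ∃ σ₀ : ℝ, 0 < σ₀ ∧ ∀ σ : ℝ, 0 < σ → σ < σ₀ →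
        ∀ (T : ℝ) (ρ θ : ℝ → T3 → ℝ) (u : ℝ → T3 → V3), IsHardSphereEulerSolution σ T ρ u θ →
          (∀ t ∈ Ico 0 T, ∀ x, ρ t x * σ ^ 3 < η) →
          ∀ Φ : (N : ℕ) → Literature.Analysis.FluidPDE.HardSphereFlow
              (Literature.Analysis.FluidPDE.Torus.geometry (Fin 3)) (hsDiameter σ N) (N + 1),
            TendstoHydroFieldsAt (fun N => localGibbsLaw σ a₀ u₀ θ₀ N (Φ N)) Φ ρ u θ 0 →
              ∀ t ∈ Ico 0 T, L2At σ a₀ θ₀ u₀ ρ θ u Φ t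

/-- **D1 assembly, PROVED**: the shared PDE crux upgrades the profile-wise guarded piece to the (unguarded) crux. -/
theorem d1_assembly (hD : DiluteSelfConsistency) (hB : PayloadClosureProfilewiseBand) : PayloadClosure := by
  intro hR a₀ θ₀ u₀ ha hθ hu ha0 hθ0
  obtain ⟨η, hη, σ₁, hσ₁, H⟩ := hB hR a₀ θ₀ u₀ ha hθ hu ha0 hθ0
  obtain ⟨σ₂, hσ₂, D⟩ := hD η hη a₀ θ₀ u₀ ha hθ hu ha0 hθ0
  refine ⟨min σ₁ σ₂, lt_min hσ₁ hσ₂, fun σ hσ hσ' T ρ θ u hsol Φ h0 t ht => ?_⟩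
  have h₁ : σ < σ₁ := lt_of_lt_of_le hσ' (min_le_left _ _)
  have h₂ : σ < σ₂ := lt_of_lt_of_le hσ' (min_le_right _ _)
  exact H σ hσ h₁ T ρ θ u hsol (fun s hs x => D σ hσ h₂ T ρ θ u hsol Φ h0 s hs x) Φ h0 t ht

/-- The crux trivially gives X₂ back (a guard hypothesis can always be ignored): X₂ is a WEAKENING of the
crux by exactly the packing guard — the honest restatement candidate, not an independent piece. -/
theorem x2_of_payloadClosure (h : PayloadClosure) : PayloadClosureProfilewiseBand := by
  intro hR a₀ θ₀ u₀ ha hθ hu ha0 hθ0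
  obtain ⟨σ₀, hσ₀, H⟩ := h hR a₀ θ₀ u₀ ha hθ hu ha0 hθ0
  exact ⟨1, one_pos, σ₀, hσ₀, fun σ hσ hσ' T ρ θ u hsol _ Φ h0 t ht => H σ hσ hσ' T ρ θ u hsol Φ h0 t ht⟩

/-- The profile-wise GUARDED mean-square waypoint (no module anywhere). -/
def L2HydroFieldsProfilewiseBand : Prop :=
  ∀ (a₀ θ₀ : T3 → ℝ) (u₀ : T3 → V3), Continuous a₀ → Continuous θ₀ → Continuous u₀ →
    (∀ x, 0 < a₀ x) → (∀ x, 0 < θ₀ x) → ∃ η : ℝ, 0 < η ∧ ∃ σ₀ : ℝ, 0 < σ₀ ∧ ∀ σ : ℝ, 0 < σ → σ < σ₀ →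
      ∀ (T : ℝ) (ρ θ : ℝ → T3 → ℝ) (u : ℝ → T3 → V3), IsHardSphereEulerSolution σ T ρ u θ →
        (∀ t ∈ Ico 0 T, ∀ x, ρ t x * σ ^ 3 < η) →
        ∀ Φ : (N : ℕ) → Literature.Analysis.FluidPDE.HardSphereFlow
            (Literature.Analysis.FluidPDE.Torus.geometry (Fin 3)) (hsDiameter σ N) (N + 1),
          TendstoHydroFieldsAt (fun N => localGibbsLaw σ a₀ u₀ θ₀ N (Φ N)) Φ ρ u θ 0 →
            ∀ t ∈ Ico 0 T, L2At σ a₀ θ₀ u₀ ρ θ u Φ t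

/-- X₂ has the same costume shape one level down: the guarded waypoint ALONE gives it (module unused). -/
theorem x2_of_profilewise (h : L2HydroFieldsProfilewiseBand) : PayloadClosureProfilewiseBand := fun _ => h

/-- … and on the module X₂ IS that guarded waypoint. -/
theorem x2_iff_profilewise (hR : CollisionPayloadTight) :
    PayloadClosureProfilewiseBand ↔ L2HydroFieldsProfilewiseBand :=
  ⟨fun h => h hR, fun h _ => h⟩

/-- Chebyshev–Markov in `ℝ≥0∞` with measurability of the tested empirical fields: the mean-square limit at time
`t` gives the in-probability limit at time `t` (the provable-now step, as in the route's `closes`). -/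
theorem tendstoHydroFieldsAt_of_l2At {σ : ℝ} {a₀ θ₀ : T3 → ℝ} {u₀ : T3 → V3} {ρ θ : ℝ → T3 → ℝ}
    {u : ℝ → T3 → V3}
    {Φ : (N : ℕ) → Literature.Analysis.FluidPDE.HardSphereFlow
      (Literature.Analysis.FluidPDE.Torus.geometry (Fin 3)) (hsDiameter σ N) (N + 1)} {t : ℝ}
    (h : L2At σ a₀ θ₀ u₀ ρ θ u Φ t) :
    TendstoHydroFieldsAt (fun N => localGibbsLaw σ a₀ u₀ θ₀ N (Φ N)) Φ ρ u θ t := by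
  have cheb : ∀ (P : (N : ℕ) → Measure (Literature.Analysis.FluidPDE.Config (N + 1) (Fin 3) T3))
      (g : (N : ℕ) → Literature.Analysis.FluidPDE.Config (N + 1) (Fin 3) T3 → ℝ),
      (∀ N, Measurable (g N)) →
      Tendsto (fun N => ∫⁻ z, ENNReal.ofReal (g N z ^ 2) ∂P N) atTop (𝓝 0) →
      ∀ δ : ℝ, 0 < δ → Tendsto (fun N => P N {z | δ < g N z}) atTop (𝓝 0) := by
    intro P g hg h δ hδ
    have hδ2 : ENNReal.ofReal (δ ^ 2) ≠ 0 := by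
      rw [Ne, ENNReal.ofReal_eq_zero, not_le]
      positivity
    have hlim : Tendsto (fun N => (∫⁻ z, ENNReal.ofReal (g N z ^ 2) ∂P N) / ENNReal.ofReal (δ ^ 2))
        atTop (𝓝 0) := by
      simpa only [ENNReal.zero_div] using ENNReal.Tendsto.div_const h (Or.inr hδ2)
    refine tendsto_of_tendsto_of_tendsto_of_le_of_le tendsto_const_nhds hlim (fun _ => zero_le)
      fun N => ?_
    calc P N {z | δ < g N z}
        ≤ P N {z | ENNReal.ofReal (δ ^ 2) ≤ ENNReal.ofReal (g N z ^ 2)} := by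
          refine measure_mono fun z hz => ?_
          simp only [mem_setOf_eq] at hz ⊢
          refine ENNReal.ofReal_le_ofReal ?_
          have h0 : 0 ≤ δ := hδ.le
          nlinarith
      _ ≤ (∫⁻ z, ENNReal.ofReal (g N z ^ 2) ∂P N) / ENNReal.ofReal (δ ^ 2) :=
          meas_ge_le_lintegral_div ((hg N).pow_const 2).ennreal_ofReal.aemeasurable hδ2
            ENNReal.ofReal_ne_top
  have hpos : ∀ {N : ℕ} (i : Fin N), Measurable fun z : Literature.Analysis.FluidPDE.Config N (Fin 3) T3 =>
      (z i).1 := fun i => (measurable_pi_apply i).fst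
  have hvel : ∀ {N : ℕ} (i : Fin N), Measurable fun z : Literature.Analysis.FluidPDE.Config N (Fin 3) T3 =>
      (z i).2 := fun i => (measurable_pi_apply i).snd
  have hint : ∀ {N : ℕ} {E : Type} [NormedAddCommGroup E] [NormedSpace ℝ E] [CompleteSpace E]
      (F : T3 × V3 → E) (z : Literature.Analysis.FluidPDE.Config N (Fin 3) T3),
      ∫ y, F y ∂Literature.Analysis.FluidPDE.empiricalMeasure z = ((N : ENNReal)⁻¹).toReal • ∑ i, F (z i) := by
    intro N E _ _ _ F z
    rw [Literature.Analysis.FluidPDE.empiricalMeasure_eq, integral_smul_measure,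
      integral_finsetSum_measure fun i _ => integrable_dirac enorm_lt_top]
    simp [integral_dirac]
  have mD : ∀ {N : ℕ} {χ : T3 → ℝ}, Continuous χ →
      Measurable fun z : Literature.Analysis.FluidPDE.Config N (Fin 3) T3 => empiricalDensityField z χ := by
    intro N χ hχ
    have : (fun z : Literature.Analysis.FluidPDE.Config N (Fin 3) T3 => empiricalDensityField z χ) =
        fun z => ((N : ENNReal)⁻¹).toReal * ∑ i, χ (z i).1 := by
      funext z; exact (hint (fun y => χ y.1) z).trans (smul_eq_mul _ _)
    rw [this]
    exact measurable_const.mul (Finset.measurable_sum _ fun i _ => hχ.measurable.comp (hpos i))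
  have mM : ∀ {N : ℕ} {χ : T3 → ℝ}, Continuous χ →
      Measurable fun z : Literature.Analysis.FluidPDE.Config N (Fin 3) T3 => empiricalMomentumField z χ := by
    intro N χ hχ
    have : (fun z : Literature.Analysis.FluidPDE.Config N (Fin 3) T3 => empiricalMomentumField z χ) =
        fun z => ((N : ENNReal)⁻¹).toReal • ∑ i, χ (z i).1 • (z i).2 := by
      funext z; exact hint (fun y => χ y.1 • y.2) z
    rw [this]
    exact (Finset.measurable_sum _ fun i _ =>
      (hχ.measurable.comp (hpos i)).smul (hvel i)).const_smul (((N : ENNReal)⁻¹).toReal)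
  have mE : ∀ {N : ℕ} {χ : T3 → ℝ}, Continuous χ →
      Measurable fun z : Literature.Analysis.FluidPDE.Config N (Fin 3) T3 => empiricalEnergyField z χ := by
    intro N χ hχ
    have : (fun z : Literature.Analysis.FluidPDE.Config N (Fin 3) T3 => empiricalEnergyField z χ) =
        fun z => ((N : ENNReal)⁻¹).toReal * ∑ i, χ (z i).1 * (‖(z i).2‖ ^ 2 / 2) := by
      funext z; exact (hint (fun y => χ y.1 * (‖y.2‖ ^ 2 / 2)) z).trans (smul_eq_mul _ _)
    rw [this]
    exact measurable_const.mul (Finset.measurable_sum _ fun i _ =>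
      (hχ.measurable.comp (hpos i)).mul (((hvel i).norm.pow_const 2).div_const 2))
  intro χ hχ δ hδ
  obtain ⟨c₁, c₂, c₃⟩ := h χ hχ
  refine ⟨?_, ?_, ?_⟩
  · exact cheb _ (fun N z => |empiricalDensityField ((Φ N).flow t z) χ - ∫ x, χ x * ρ t x|)
      (fun N => (((mD hχ).comp ((Φ N).measurable_flow t)).sub_const _).abs) c₁ δ hδ
  · exact cheb _ (fun N z => ‖empiricalMomentumField ((Φ N).flow t z) χ - ∫ x, (χ x * ρ t x) • u t x‖)
      (fun N => (((mM hχ).comp ((Φ N).measurable_flow t)).sub_const _).norm) c₂ δ hδ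
  · exact cheb _ (fun N z => |empiricalEnergyField ((Φ N).flow t z) χ -
        ∫ x, χ x * totalEnergyDensity (ρ t x) (u t x) (θ t x)|)
      (fun N => (((mE hχ).comp ((Φ N).measurable_flow t)).sub_const _).abs) c₃ δ hδ

/-- X₂ + module ⇒ the PROFILE-WISE GUARDED hydrodynamic limit `HydroLimitProfilewiseBand` (stmt-17372 — the crux of
route ImplosionDichotomy whose docstring reads "It is the hydrodynamic limit itself under a packing cap"): so the
"easier" piece of D1 is again the (guarded) summit given an a-priori bound. -/
theorem profilewise_summit_of_x2 (hR : CollisionPayloadTight) (h : PayloadClosureProfilewiseBand) :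
    HydroLimitProfilewiseBand := by
  intro a₀ θ₀ u₀ ha hθ hu ha0 hθ0
  obtain ⟨η, hη, σ₀, hσ₀, H⟩ := h hR a₀ θ₀ u₀ ha hθ hu ha0 hθ0
  exact ⟨η, hη, σ₀, hσ₀, fun σ hσ hσ' T ρ θ u hsol hg Φ h0 t ht =>
    tendstoHydroFieldsAt_of_l2At (H σ hσ hσ' T ρ θ u hsol hg Φ h0 t ht)⟩

/-- … and with the other D1 piece it reaches the summit conjunct (this is `ImplosionDichotomy.closes` re-run): D1 is
"attach the module to route ImplosionDichotomy", not a decomposition of THIS crux. -/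
theorem summit_of_d1 (hD : DiluteSelfConsistency) (hR : CollisionPayloadTight)
    (h : PayloadClosureProfilewiseBand) : _root_.HydrodynamicLimit :=
  Summit.AtomisticToContinuum.HydrodynamicLimit.Theses.ImplosionDichotomy.closes hD
    (profilewise_summit_of_x2 hR h)

end Summit.AtomisticToContinuum.HydrodynamicLimit.Cruxes.PayloadClosure.Census
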